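import Literature.Topology.FourManifolds.HCobordismWallAssembly
import Literature.Topology.FourManifolds.MergingCobordism
import HarnessLib

/-!
# Wall's Theorem 2 from a Lagrangian filling of ANY manifold h-cobordant to `M₁ # (−M₂)`

Topic `Literature/Topology/FourManifolds`; fact seat of
`Literature.Topology.FourManifolds.isHCobordant_of_equivalent_intersectionForm` (**C. T. C. Wall,
*On simply-connected 4-manifolds*, J. London Math. Soc. 39 (1964) 141–149, Thm. 2**: closed
smooth simply connected 4-manifolds with isometric intersection forms are h-cobordant).

`HCobordismWallAssembly.lean` proves Thm. 2 along Wall's §2 from four inputs, two of which —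
Wall's Thm. 1 and Lemma 2 — serve only to PRODUCE the pair (`V`, `C`): a handlebody
`V ∈ ℋ(5, k, 2)` and an h-cobordism `C` from `N = M₁ # (−M₂)` to `∂V`; the rest of §2 (the
re-gluing `R = (V ∪_g C) ∪_N W₀` and the computation of `H₂(R)`) uses of `V` only that it is a
compact simply connected 5-manifold with `H₂(∂V) → H₂(V)` onto and `H₂(V)` free, and of the
diffeomorphism theory of `∂V` only the MOVER `g` with `g^*(K′) = L = im (H²(V)/T → H²(∂V)/T)` for
the transported graph `K′` of the isometry (a Lagrangian direct summand of half rank).  This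
file records that reading as a theorem, **`isHCobordant_of_wallFilling`: Wall's Thm. 2 for the
pair `(M₁, M₂)` from ANY such filling of any closed manifold h-cobordant to `M₁ # (−M₂)`**
(hypothesis `hfill`, quantified over the connected sums `N` with their lattice splitting
`H²(N)/T ≅ H²(M₁)/T ⊕ H²(M₂)/T`), the merging cobordism being the tree's
`MergingCobordism.hmerge_holds`.  It is the entry point of WALL'S TRICK for the realisation line
of `HCobordismKirbyRealisation.lean`: the form of `N = M₁ # (−M₂)` is `Q ⊥ (−Q) ≅ k·H` (for even
`Q`), CORE-FREE, so an h-cobordism from `N` to the boundary `𝕊⁴ # k(S² × S²)` of the standard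
filling is available from the realisation of Kirby's generators of one summand, with no
hyperbolic pair required in `Q` itself (sequel files).

* `exists_regluing_cobordism_of_boundaryData` — the re-gluing `R = (V ∪_g C) ∪_N W₀` of
  `HCobordismWallAssembly.lean` with `∂V` presented by an arbitrary boundary datum (same proof).
* `surjective_comp_of_wall_lattice_data_of_annihilator` — Wall's computation of
  `H₂(Mᵢ) → H₂(R)` (p. 146) with the filling entering only through a detector
  `π₀ : H₂(∂V) → F₀` (`F₀` projective) of classes dying in `V` and a submodule
  `L ⊇ Ann (ker π₀)` carrying Wall's condition (no (co)homology of `V`).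
* `isHCobordant_of_wallFilling_of_annihilator` — Thm. 2 for `(M₁, M₂)` from such a filling with a
  mover onto `L`; proof = that of `isHCobordant_of_constructions_pair` with Thm. 1 + Lemma 2 + the
  realisation fact replaced by `hfill`.
* `isHCobordant_of_wallFilling` — the same with `π₀ = ι_*`, `L = im (H²(V)/T → H²(∂V)/T)` and
  `H₂(V)` free (Kronecker duality, `mem_range_iff_forall_mem_ker_pairing_eq_zero`).

Everything is proved; no named fact and no definition is introduced.

## References

* C. T. C. Wall, *On simply-connected 4-manifolds*, J. London Math. Soc. 39 (1964) 141–149,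
  Thm. 2 and §2 pp. 144–146. [WallJLMS1964]
* J. Milnor, *Lectures on the h-cobordism theorem*, Princeton (1965), §1 Thm. 1.4.
  [MilnorHCobordism1965]
* A. Hatcher, *Algebraic Topology*, CUP (2002), §2.2, §3.1. [HatcherAT2002]
-/

open scoped Manifold ContDiff Topology
open Set Function Module CategoryTheory CategoryTheory.Limits
open Literature.AlgebraicTopology.SingularHomology Literature.AlgebraicTopology.Homotopy

noncomputable section

namespace Literature.Topology.FourManifolds

/-- Local notation: `𝔼 n` is the model Euclidean space `EuclideanSpace ℝ (Fin n)`. -/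
local notation "𝔼 " n:arg => EuclideanSpace ℝ (Fin n)

/-- Local notation: `Q⟦μ⟧` is the intersection form on `H²(M; ℤ)/T` of the closed `ℤ`-oriented
topological 4-manifold `(M, μ)` (as in `HCobordismDonaldson.lean`). -/
local notation "Q⟦" μ "⟧" =>
  Literature.AlgebraicTopology.SingularHomology.intersectionForm two_add_two_eq_four μ

/-! ### The re-gluing over an abstract boundary datum -/

section Regluing

variable (H : Type) [TopologicalSpace H] [T2Space H] [SecondCountableTopology H]
  [ChartedSpace (EuclideanHalfSpace (4 + 1)) H] [IsManifold (𝓡∂ (4 + 1)) ∞ H] [CompactSpace H]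
  (b : BoundaryData (𝓡∂ (4 + 1)) H (𝓡 4)) [CompactSpace b.carrier]
  {N : Type} [TopologicalSpace N] [ChartedSpace (𝔼 4) N] [IsManifold (𝓡 4) ∞ N] [CompactSpace N]
  {M₁ M₂ : Type} [TopologicalSpace M₁] [ChartedSpace (𝔼 4) M₁] [IsManifold (𝓡 4) ∞ M₁]
  [CompactSpace M₁] [TopologicalSpace M₂] [ChartedSpace (𝔼 4) M₂] [IsManifold (𝓡 4) ∞ M₂]
  [CompactSpace M₂]

/-- **The re-gluing of Wall's `R`, over an abstract filling** (the theorem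
`exists_regluing_cobordism` of `HCobordismWallAssembly.lean` with the boundary `∂V` presented by
an arbitrary boundary datum `b` of `V` instead of the boundary subtype; same proof; 1964, pp. 145–146: "We now take the h-cobordism of
`M₁ # (−M₂)` to `∂V`, and 'fill in' `∂V` by attaching `V` [along the diffeomorphism inducing the
chosen automorph] … and fill in `S³ × I` by attaching `D⁴ × I`. We have now constructed a
manifold `R` whose boundary components are `M₁` and `M₂`; we claim that `R` is an h-cobordism.
First, it is clear from construction that `R` is simply-connected"). INPUT: a compact simply
connected `V⁵` (`H`) with `H₂(∂V; ℤ) → H₂(V; ℤ)` onto and `∂V` simply connected, an h-cobordism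
`C` from `N` to `∂V` with `N` simply connected, a self-diffeomorphism `g` of `∂V`, and a
cobordism `W₀` from `N` to `M₁ ⊔ M₂` with simply connected total space (the neck-filling).
OUTPUT: a cobordism `R` from `M₁` to `M₂` — `R₀ = V ∪_g C` (`exists_cobordismAttachment_holds`,
Milnor Thm. 1.4, the twist `g` being the identification `∂V ≅` incoming end of `C.symm`) and
`R = R₀ ∪_N W₀` read as a cobordism between the summands of the far end
(`CobordismAttachment.toCobordismOfSum`) — such that: `R` is simply connected (van Kampen,
`CobordismAttachment.simplyConnectedSpace`, twice); `jX_* : H₂(W₀) → H₂(R)` is onto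
(Mayer–Vietoris, `CobordismAttachment.epi_map_jX_of_epi`, twice: `H₂(∂V) → H₂(V)` onto,
`H₂(N) ≅ H₂(C) → H₂(R₀)` onto); the ends of `R` are `jX ∘ inr ∘ Sum.inl/inr`; and for every
`y ∈ ker (H₂(∂V) → H₂(V))` and `n ∈ H₂(N)` with `inl_* n = inr_* (g_* y)` in `H₂(C)` the class
`jX_* (inl_* n)` vanishes in `H₂(R)` ("If we attach `V`, the kernel of `H₂(∂V) → H₂(V)` is `L`").
[cite: WallJLMS1964, §2 pp. 145–146] [cite: MilnorHCobordism1965, §1, Thm. 1.4] -/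
theorem exists_regluing_cobordism_of_boundaryData [SimplyConnectedSpace H] [SimplyConnectedSpace N]
    [SimplyConnectedSpace b.carrier]
    (hepi : Epi (singularHomology.map ℤ ℤ
      b.inclC 2))
    (C : Cobordism 4 N b.carrier) (hC : C.IsHCobordism)
    (g : b.carrier ≃ₘ⟮𝓡 4, 𝓡 4⟯ b.carrier)
    (W₀ : Cobordism 4 N (M₁ ⊕ M₂)) [SimplyConnectedSpace W₀.W] :
    ∃ (Rc : Cobordism 4 M₁ M₂) (_ : SimplyConnectedSpace Rc.W) (J : C(W₀.W, Rc.W)),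
      Epi (singularHomology.map ℤ ℤ J 2) ∧
      (⟨Rc.inl, Rc.continuous_inl⟩ : C(M₁, Rc.W)) =
        J.comp ⟨W₀.inr ∘ Sum.inl, W₀.continuous_inr.comp continuous_inl⟩ ∧
      (⟨Rc.inr, Rc.continuous_inr⟩ : C(M₂, Rc.W)) =
        J.comp ⟨W₀.inr ∘ Sum.inr, W₀.continuous_inr.comp continuous_inr⟩ ∧
      ∀ (y : singularHomology ℤ ℤ b.carrier 2) (n : singularHomology ℤ ℤ N 2),
        singularHomology.map ℤ ℤ
            b.inclC 2 y = 0 →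
        singularHomology.map ℤ ℤ (⟨C.inl, C.continuous_inl⟩ : C(N, C.W)) 2 n =
          singularHomology.map ℤ ℤ (⟨C.inr, C.continuous_inr⟩ : C(b.carrier, C.W)) 2
            (singularHomology.map ℤ ℤ (⟨g, g.continuous⟩ : C(b.carrier, b.carrier)) 2 y) →
        singularHomology.map ℤ ℤ J 2
          (singularHomology.map ℤ ℤ (⟨W₀.inl, W₀.continuous_inl⟩ : C(N, W₀.W)) 2 n) = 0 := by
  -- the h-cobordism reversed: from `∂V` to `N`, simply connected
  set C' : Cobordism 4 b.carrier N := C.symm with hC'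
  haveI : SimplyConnectedSpace C.W := hC.simplyConnectedSpace
  haveI : SimplyConnectedSpace C'.W := ‹SimplyConnectedSpace C.W›
  -- `R₀ = V ∪_g C'`
  obtain ⟨R₀, i1, i2, i3, i4, i5, ⟨At₀⟩⟩ := exists_cobordismAttachment_holds 3 H b
    b.carrier N C' g
  haveI := At₀.compactSpace
  haveI : SimplyConnectedSpace R₀ := At₀.simplyConnectedSpace
  have h1d : IsZero (singularHomology ℤ ℤ b.carrier 1) :=
    isZero_singularHomology_one_of_simplyConnectedSpace ℤ ℤ
  haveI : Epi (singularHomology.map ℤ ℤ b.inclC (1 + 1)) := hepi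
  have hepi₀ : Epi (singularHomology.map ℤ ℤ At₀.jXC (1 + 1)) := At₀.epi_map_jX_of_epi ℤ ℤ h1d
  -- `R = R₀ ∪_N W₀`
  obtain ⟨R, j1, j2, j3, j4, j5, ⟨At⟩⟩ := exists_cobordismAttachment_holds 3 R₀ At₀.boundaryData
    N (M₁ ⊕ M₂) W₀ (Diffeomorph.refl (𝓡 4) N ∞)
  haveI := At.compactSpace
  haveI : SimplyConnectedSpace R := At.simplyConnectedSpace
  have h1N : IsZero (singularHomology ℤ ℤ N 1) := isZero_singularHomology_one_of_simplyConnectedSpace ℤ ℤ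
  -- `H₂(N) → H₂(R₀)` (the boundary inclusion of `R₀`) is onto: `N ≅ H₂(C) ↠ H₂(R₀)`
  have hmapfac : singularHomology.map ℤ ℤ At₀.boundaryData.inclC (1 + 1) =
      singularHomology.map ℤ ℤ (⟨C.inl, C.continuous_inl⟩ : C(N, C.W)) (1 + 1) ≫
        singularHomology.map ℤ ℤ At₀.jXC (1 + 1) :=
    singularHomology.map_comp ℤ ℤ (⟨C.inl, C.continuous_inl⟩ : C(N, C.W)) At₀.jXC (1 + 1)
  have hEpi₁ : Epi (singularHomology.map ℤ ℤ (⟨C.inl, C.continuous_inl⟩ : C(N, C.W)) (1 + 1)) :=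
    @IsIso.epi_of_iso _ _ _ _ _ (hC.isIso_map_inl (1 + 1))
  haveI : Epi (singularHomology.map ℤ ℤ At₀.boundaryData.inclC (1 + 1)) :=
    hmapfac ▸ @epi_comp _ _ _ _ _ _ hEpi₁ _ hepi₀
  have hepiJ : Epi (singularHomology.map ℤ ℤ At.jXC (1 + 1)) := At.epi_map_jX_of_epi ℤ ℤ h1N
  -- the cobordism `R` from `M₁` to `M₂`
  refine ⟨At.toCobordismOfSum, ‹SimplyConnectedSpace R›, At.jXC, hepiJ, rfl, rfl, ?_⟩
  -- the vanishing: `jX_* (inl₀_* n) = jW_* (jX₀_* (C.inl_* n)) = jW_* (jX₀_* (C.inr_* (g_* y)))`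
  --   `= jW_* (jH_* (val_* y)) = 0`
  intro y n hy hn
  have hseam : (At.jXC.comp (⟨W₀.inl, W₀.continuous_inl⟩ : C(N, W₀.W))) =
      (At.jWC.comp (At₀.jXC.comp (⟨C.inl, C.continuous_inl⟩ : C(N, C.W)))) := by
    ext x
    exact (At.jW_incl x).symm
  have hseam₀ : (At₀.jXC.comp ((⟨C.inr, C.continuous_inr⟩ : C(b.carrier, C.W)).comp
      (⟨g, g.continuous⟩ : C(b.carrier, b.carrier)))) =
      At₀.jWC.comp b.inclC := by
    ext z
    exact (At₀.jW_incl z).symm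
  have e1 : singularHomology.map ℤ ℤ At.jXC 2
      (singularHomology.map ℤ ℤ (⟨W₀.inl, W₀.continuous_inl⟩ : C(N, W₀.W)) 2 n) =
      singularHomology.map ℤ ℤ At.jWC 2 (singularHomology.map ℤ ℤ At₀.jXC 2
        (singularHomology.map ℤ ℤ (⟨C.inl, C.continuous_inl⟩ : C(N, C.W)) 2 n)) := by
    have h := congrArg (fun φ : C(N, R) => singularHomology.map ℤ ℤ φ 2 n) hseam
    simp only [singularHomology.map_comp, ModuleCat.comp_apply] at h
    exact h
  have e2 : singularHomology.map ℤ ℤ At₀.jXC 2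
      (singularHomology.map ℤ ℤ (⟨C.inr, C.continuous_inr⟩ : C(b.carrier, C.W)) 2
        (singularHomology.map ℤ ℤ (⟨g, g.continuous⟩ : C(b.carrier, b.carrier)) 2 y)) =
      singularHomology.map ℤ ℤ At₀.jWC 2 (singularHomology.map ℤ ℤ
        b.inclC 2 y) := by
    have h := congrArg (fun φ : C(b.carrier, R₀) =>
      singularHomology.map ℤ ℤ φ 2 y) hseam₀
    simp only [singularHomology.map_comp, ModuleCat.comp_apply] at h
    have hsplit : singularHomology.map ℤ ℤ
        ((⟨C.inr, C.continuous_inr⟩ : C(b.carrier, C.W)).comp (⟨g, g.continuous⟩ : C(b.carrier, b.carrier))) 2 y =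
        singularHomology.map ℤ ℤ (⟨C.inr, C.continuous_inr⟩ : C(b.carrier, C.W)) 2
          (singularHomology.map ℤ ℤ (⟨g, g.continuous⟩ : C(b.carrier, b.carrier)) 2 y) := by
      rw [singularHomology.map_comp, ModuleCat.comp_apply]
    first
      | exact h
      | exact hsplit ▸ h
  calc _ = singularHomology.map ℤ ℤ At.jWC 2 (singularHomology.map ℤ ℤ At₀.jXC 2
          (singularHomology.map ℤ ℤ (⟨C.inl, C.continuous_inl⟩ : C(N, C.W)) 2 n)) := e1
    _ = singularHomology.map ℤ ℤ At.jWC 2 (singularHomology.map ℤ ℤ At₀.jXC 2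
          (singularHomology.map ℤ ℤ (⟨C.inr, C.continuous_inr⟩ : C(b.carrier, C.W)) 2
            (singularHomology.map ℤ ℤ (⟨g, g.continuous⟩ : C(b.carrier, b.carrier)) 2 y))) :=
        congrArg (fun t => singularHomology.map ℤ ℤ At.jWC 2 (singularHomology.map ℤ ℤ At₀.jXC 2 t)) hn
    _ = singularHomology.map ℤ ℤ At.jWC 2 (singularHomology.map ℤ ℤ At₀.jWC 2
          (singularHomology.map ℤ ℤ
            b.inclC 2 y)) :=
        congrArg (fun t => singularHomology.map ℤ ℤ At.jWC 2 t) e2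
    _ = singularHomology.map ℤ ℤ At.jWC 2 (singularHomology.map ℤ ℤ At₀.jWC 2 0) :=
        congrArg (fun t => singularHomology.map ℤ ℤ At.jWC 2 (singularHomology.map ℤ ℤ At₀.jWC 2 t)) hy
    _ = 0 := by simp only [map_zero]

end Regluing

/-! ### The computation, with the filling entering through a sub-Lagrangian -/

section Algebra

variable {C₁ C₂ Wc Cd H₁ H₂ Wh Hd F₀ X : Type*}
  [AddCommGroup C₁] [Module ℤ C₁] [AddCommGroup C₂] [Module ℤ C₂] [AddCommGroup Wc] [Module ℤ Wc]
  [AddCommGroup Cd] [Module ℤ Cd]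
  [AddCommGroup H₁] [Module ℤ H₁] [AddCommGroup H₂] [Module ℤ H₂] [AddCommGroup Wh] [Module ℤ Wh]
  [AddCommGroup Hd] [Module ℤ Hd] [AddCommGroup F₀] [Module ℤ F₀] [Module.Projective ℤ F₀]
  [AddCommGroup X] [Module ℤ X]

/-- **Wall's computation of `H₂(Mᵢ) → H₂(R)`, with the filling entering only through a
detector of classes dying in `V`** — the algebra of `surjective_comp_of_wall_lattice_data`
(`HCobordismWallAssembly.lean`, Wall 1964 p. 146) with its use of `V` analysed.  There the
filling enters through `ι_* = ι_h : H₂(∂V) → H₂(V)` (onto, `H₂(V)` projective) and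
`L = im ι^*`, and the proof uses: (a) classes killed by `ι_*` die in `R` (`hvan`); (b) a
cohomology class killing `ker ι_*` lies in `L` (Kronecker duality); (c) `ker ι_*` is the kernel of
a map to a projective module (to identify a kernel with its double annihilator).  Here (a)–(c) are
asked of an arbitrary linear `π₀ : H₂(∂V) → F₀`, `F₀` projective, in place of `ι_*`: `hvan` for
`ker π₀` (so `ker π₀ ⊆ ker ι_*` in the application), `hAnn : Ann (ker π₀) ⊆ L`, and Wall's
condition `g^*(Φ_c(K)) = L` for that `L`; no (co)homology of `V` appears.  Same conclusion, same
proof. [cite: WallJLMS1964, §2 p. 146] -/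
theorem surjective_comp_of_wall_lattice_data_of_annihilator
    (κN : Wc →ₗ[ℤ] Wh →ₗ[ℤ] ℤ) [κN.IsPerfPair] (κ₁ : C₁ →ₗ[ℤ] H₁ →ₗ[ℤ] ℤ) [κ₁.IsPerfPair]
    (κ₂ : C₂ →ₗ[ℤ] H₂ →ₗ[ℤ] ℤ) [κ₂.IsPerfPair] (κd : Cd →ₗ[ℤ] Hd →ₗ[ℤ] ℤ) [κd.IsPerfPair]
    -- the connected-sum splitting and its homological transpose
    {cMc : C₁ →ₗ[ℤ] Wc} {cNc : C₂ →ₗ[ℤ] Wc} {sM : Wc →ₗ[ℤ] C₁} {sN : Wc →ₗ[ℤ] C₂}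
    {sh : Wh →ₗ[ℤ] H₁} {th : Wh →ₗ[ℤ] H₂}
    (hadjM : ∀ a x, κN (cMc a) x = κ₁ a (sh x)) (hadjN : ∀ b x, κN (cNc b) x = κ₂ b (th x))
    (h1 : ∀ w, cMc (sM w) + cNc (sN w) = w) (h2 : ∀ a b, sM (cMc a + cNc b) = a)
    (h3 : ∀ a b, sN (cMc a + cNc b) = b)
    -- the isometry
    {α : C₁ →ₗ[ℤ] C₂} (hα : Bijective α)
    -- the h-cobordism
    {Φc : Wc →ₗ[ℤ] Cd} {Φh : Hd →ₗ[ℤ] Wh} {Ψh : Wh →ₗ[ℤ] Hd}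
    (hΦ : ∀ w y, κN w (Φh y) = κd (Φc w) y) (hΦc : Injective Φc)
    (hΦΨ : ∀ x, Φh (Ψh x) = x) (hΨΦ : ∀ y, Ψh (Φh y) = y)
    -- the diffeomorphism
    {gc : Cd →ₗ[ℤ] Cd} {gh gh' : Hd →ₗ[ℤ] Hd} (hg : ∀ a y, κd (gc a) y = κd a (gh y))
    (hgc : Injective gc) (hgg' : ∀ y, gh (gh' y) = y) (hg'g : ∀ y, gh' (gh y) = y)
    -- the filling: a detector `π₀` of dying classes and a submodule `L ⊇ Ann (ker π₀)`
    (π₀ : Hd →ₗ[ℤ] F₀) {L : Submodule ℤ Cd}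
    (hAnn : ∀ c : Cd, (∀ y, π₀ y = 0 → κd c y = 0) → c ∈ L)
    -- Wall's condition `g^*(Φ_c(K)) = L`
    (hWall : ((graphSubmodule sM sN α).map Φc).map gc = L)
    -- the geometric map `H₂(N) → H₂(R)`, killing the classes detected by `π₀`
    {F : Wh →ₗ[ℤ] X} (hF : Surjective F) (hvan : ∀ y, π₀ y = 0 → F (Φh (gh y)) = 0)
    -- the summand inclusions
    {i₁ : H₁ →ₗ[ℤ] Wh} (hi₁s : ∀ z, sh (i₁ z) = z) (hi₁t : ∀ z, th (i₁ z) = 0)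
    {i₂ : H₂ →ₗ[ℤ] Wh} (hi₂s : ∀ z, sh (i₂ z) = 0) (hi₂t : ∀ z, th (i₂ z) = z) :
    Surjective (F ∘ₗ i₁) ∧ Surjective (F ∘ₗ i₂) := by
  -- (1) the homological splitting is a splitting
  have hc : Bijective fun ab : C₁ × C₂ => cMc ab.1 + cNc ab.2 := by
    refine ⟨fun ab ab' h => ?_, fun w => ⟨(sM w, sN w), h1 w⟩⟩
    have ha := congrArg sM h
    have hb := congrArg sN h
    simp only [h2, h3] at ha hb
    exact Prod.ext ha hb
  have hst : Bijective fun x : Wh => (sh x, th x) :=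
    bijective_transpose_of_bijective κN κ₁ κ₂ hadjM hadjN hc
  have hts : Bijective fun x : Wh => (th x, sh x) :=
    (Equiv.prodComm H₁ H₂).bijective.comp hst
  -- (2) the adjoint `α†` of `α`, a bijection `H₂ → H₁`
  obtain ⟨β, hβ, hαβ⟩ := exists_adjoint_bijective κ₁ κ₂ hα
  have hβ' : Bijective (-β) := by
    refine ⟨fun x y h => hβ.1 (neg_injective ?_), fun z => ?_⟩
    · simpa using h
    · obtain ⟨y, hy⟩ := hβ.2 (-z)
      exact ⟨y, by simp [hy]⟩
  -- (3) the decomposition of `κN` along the splitting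
  have hκ : ∀ w x, κN w x = κ₁ (sM w) (sh x) + κ₂ (sN w) (th x) := fun w x => by
    conv_lhs => rw [← h1 w]
    rw [map_add, LinearMap.add_apply, hadjM, hadjN]
  -- (4) the kernel `D = Φ_h (g_h (ker π₀)) = ker (π₀ ∘ g_h⁻¹ ∘ Φ_h⁻¹)`
  let πH : Wh →ₗ[ℤ] F₀ := π₀ ∘ₗ gh' ∘ₗ Ψh
  have hπH : ∀ x, x ∈ LinearMap.ker πH ↔ π₀ (gh' (Ψh x)) = 0 := fun x => by
    rw [LinearMap.mem_ker]; rfl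
  -- (5) Wall's condition: every `a ∈ W_c` killing `ker πH` lies in the graph `K`
  have hK : ∀ a : Wc, (∀ d ∈ LinearMap.ker πH, κN a d = 0) →
      a ∈ graphSubmodule sM sN α := by
    intro a ha
    -- `g^*(Φ_c a)` kills `ker π₀`, hence lies in `L = g^*(Φ_c(K))`
    have hmem : gc (Φc a) ∈ L := by
      refine hAnn _ fun y hy => ?_
      have hd : Φh (gh y) ∈ LinearMap.ker πH := by
        rw [hπH, hΨΦ, hg'g]
        exact hy
      have h0 := ha _ hd
      rwa [hΦ, ← hg] at h0
    rw [← hWall] at hmem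
    obtain ⟨_, ⟨k, hk, rfl⟩, hk'⟩ := hmem
    have hka : k = a := hΦc (hgc hk')
    rwa [hka] at hk
  -- (6) the homological graph of `−α†` dies under `πH`, hence under `F`
  have hgraph : graphSubmodule th sh (-β) ≤ LinearMap.ker πH :=
    graphSubmodule_le_ker_of_forall κN (LinearMap.IsPerfPair.bijective_left κN).2 κ₁ κ₂ hκ
      hαβ πH hK
  have hkerF : graphSubmodule th sh (-β) ≤ LinearMap.ker F := by
    intro x hx
    have hxπ := hgraph hx
    rw [hπH] at hxπ
    rw [LinearMap.mem_ker]
    have hx' : x = Φh (gh (gh' (Ψh x))) := by rw [hgg', hΦΨ]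
    rw [hx']
    exact hvan _ hxπ
  -- (7) the graph is complementary to both summands
  exact ⟨surjective_comp_inr_of_graphSubmodule_le_ker hts (-β) hF hkerF hi₁t hi₁s,
    surjective_comp_inl_of_graphSubmodule_le_ker hts hβ'.2 hF hkerF hi₂t hi₂s⟩

end Algebra

/-! ### Theorem 2 from a filling -/

section Filling

/-- **Wall's Theorem 2 for ONE pair from a filling of a manifold h-cobordant to `M₁ # (−M₂)`,
the filling entering only through a detector of dying classes** — the sharper form of
`isHCobordant_of_wallFilling` below: the clause `hfill` asks, for every admissible `N`, for a
compact simply connected smooth `V⁵` with boundary datum `bV`, an h-cobordism `C` from `N` to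
`∂V`, `ι_* : H₂(∂V) → H₂(V)` onto, a linear `π₀ : H₂(∂V) → F₀` to a projective `F₀` whose kernel
dies in `V` (`ker π₀ ⊆ ker ι_*`), a submodule `L ⊆ H²(∂V)/T` containing every class that kills
`ker π₀` under the Kronecker pairing, and the MOVER carrying every Lagrangian direct summand of
half rank onto `L` by a diffeomorphism.  (For `π₀ = ι_*`, `L = im (H²(V)/T → H²(∂V)/T)` the
containment is Kronecker duality and needs `H₂(V)` projective: `isHCobordant_of_wallFilling`;
asking only for `π₀`, `L` lets a filling be fed in whose (co)homology is not computed — the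
standard filling of `𝕊⁴ # k(S² × S²)`, sequel — as soon as enough classes of `∂V` are known to
die in `V`.)  PROOF: as `isHCobordant_of_wallFilling`, with the computation
`surjective_comp_of_wall_lattice_data_of_annihilator`.
[cite: WallJLMS1964, Thm. 2 and §2 pp. 144–146] -/
theorem isHCobordant_of_wallFilling_of_annihilator
    (M₁ M₂ : Type) [TopologicalSpace M₁] [T2Space M₁] [SecondCountableTopology M₁]
    [ChartedSpace (𝔼 4) M₁] [CompactSpace M₁] [IsManifold (𝓡 4) ∞ M₁] [SimplyConnectedSpace M₁]
    [TopologicalSpace M₂] [T2Space M₂] [SecondCountableTopology M₂]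
    [ChartedSpace (𝔼 4) M₂] [CompactSpace M₂] [IsManifold (𝓡 4) ∞ M₂] [SimplyConnectedSpace M₂]
    (μ : HomologicalOrientation ℤ M₁ 4) (ν : HomologicalOrientation ℤ M₂ 4)
    (hfill : ∀ (N : Type) [TopologicalSpace N] [T2Space N] [SecondCountableTopology N]
      [ChartedSpace (𝔼 4) N] [CompactSpace N] [IsManifold (𝓡 4) ∞ N] [SimplyConnectedSpace N]
      (π : HomologicalOrientation ℤ N 4)
      (sM : freeCohomology ℤ N 2 →ₗ[ℤ] freeCohomology ℤ M₁ 2)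
      (sN : freeCohomology ℤ N 2 →ₗ[ℤ] freeCohomology ℤ M₂ 2),
      Function.Bijective (fun x => (sM x, sN x)) →
      (∀ x y, Q⟦π⟧ x y = Q⟦μ⟧ (sM x) (sM y) - Q⟦ν⟧ (sN x) (sN y)) →
      ∃ (V : Type) (_ : TopologicalSpace V) (_ : T2Space V) (_ : SecondCountableTopology V)
        (_ : ChartedSpace (EuclideanHalfSpace (4 + 1)) V) (_ : IsManifold (𝓡∂ (4 + 1)) ∞ V)
        (_ : CompactSpace V) (_ : SimplyConnectedSpace V)
        (bV : BoundaryData (𝓡∂ (4 + 1)) V (𝓡 4)) (_ : T2Space bV.carrier)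
        (_ : CompactSpace bV.carrier) (C : Cobordism 4 N bV.carrier)
        (F₀ : Type) (_ : AddCommGroup F₀) (_ : Module ℤ F₀) (_ : Module.Projective ℤ F₀)
        (π₀ : singularHomology ℤ ℤ bV.carrier 2 →ₗ[ℤ] F₀)
        (L : Submodule ℤ (freeCohomology ℤ bV.carrier 2)),
        C.IsHCobordism ∧ Epi (singularHomology.map ℤ ℤ bV.inclC 2) ∧
        (∀ y : singularHomology ℤ ℤ bV.carrier 2, π₀ y = 0 →
          singularHomology.map ℤ ℤ bV.inclC 2 y = 0) ∧
        (∀ c : freeCohomology ℤ bV.carrier 2,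
          (∀ y : singularHomology ℤ ℤ bV.carrier 2, π₀ y = 0 →
            freeKroneckerPairing bV.carrier 2 c y = 0) → c ∈ L) ∧
        ∀ (β : HomologicalOrientation ℤ bV.carrier 4)
          (K : Submodule ℤ (freeCohomology ℤ bV.carrier 2)),
          (∃ K' : Submodule ℤ (freeCohomology ℤ bV.carrier 2), IsCompl K K') →
          (∀ x ∈ K, ∀ y ∈ K, Q⟦β⟧ x y = 0) →
          2 * finrank ℤ K = finrank ℤ (freeCohomology ℤ bV.carrier 2) →
          ∃ g : bV.carrier ≃ₘ⟮𝓡 4, 𝓡 4⟯ bV.carrier,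
            Submodule.map (freeCohomology.map (R := ℤ) (⟨g, g.continuous⟩ : C(bV.carrier, bV.carrier)) 2) K = L)
    (h : (Q⟦μ⟧).Equivalent (Q⟦ν⟧)) : IsHCobordant 4 M₁ M₂ := by
  classical
  obtain ⟨α⟩ := h
  -- "Form the connected sum `N = M₁ # (−M₂)`. Since the signatures … that of `N` is zero."
  obtain ⟨N, i1, i2, i3, i4, i5, i6, i7, o₁, o₂, oN, π, hsum, ho₁, ho₂, hπ⟩ :=
    exists_isOrientedConnectedSum_neg_isCompatible (n := 4) (by norm_num) M₁ M₂
      (HomologicalOrientationOfSmooth.μE 4) μ ν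
  -- the gluing data of `N`, with its SMOOTH disc and gluing maps (kept for the merging step)
  obtain ⟨i₁, i₂, _, jA, jB, hi₁, hi₂, -, -, ⟨hjA, hAo, hjB, hBo, hUn, hRel⟩, hoA, hoB⟩ := hsum
  let d : ConnectedSumNeck 4 M₁ M₂ N :=
    { i₁ := i₁
      i₂ := i₂
      jA := jA
      jB := jB
      continuous_i₁ := hi₁.isEmbedding.continuous
      injective_i₁ := hi₁.isEmbedding.injective
      continuous_i₂ := hi₂.isEmbedding.continuous
      injective_i₂ := hi₂.isEmbedding.injective
      isEmbedding_jA := hjA.isEmbedding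
      isEmbedding_jB := hjB.isEmbedding
      isOpen_range_jA := hAo
      isOpen_range_jB := hBo
      union_range := hUn
      rel := hRel }
  have hL : d.IsOrientedLeft μ π :=
    d.isOrientedLeft_of_isOrientationPreserving hjA (HomologicalOrientationOfSmooth.μE 4) ho₁ hπ hoA
  have hR : d.IsOrientedRight (-ν) π :=
    d.isOrientedRight_of_isOrientationPreserving hjB (HomologicalOrientationOfSmooth.μE 4) ho₂ hπ hoB
  obtain ⟨sM, sN, hd1, hd2, hd3, hst, hQ'⟩ :=
    d.exists_decomposition_intersectionForm (m := 3) (by norm_num) (k := 2) (by norm_num)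
      two_add_two_eq_four hL hR
  have hQ : ∀ x y, Q⟦π⟧ x y = Q⟦μ⟧ (sM x) (sM y) - Q⟦ν⟧ (sN x) (sN y) := fun x y => by
    refine (hQ' x y).trans ?_
    show intersectionForm two_add_two_eq_four μ (sM x) (sM y) +
        intersectionForm two_add_two_eq_four (-ν) (sN x) (sN y) = _
    rw [intersectionForm_neg (HomologicalOrientation.fundamentalClass_neg_holds ℤ M₂ 4)
      two_add_two_eq_four ν, LinearMap.neg_apply, LinearMap.neg_apply, sub_eq_add_neg]
  -- the filling `V` of `∂V = bV.carrier`, the h-cobordism `C : N ∼ ∂V`, and the mover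
  obtain ⟨H, k1, k2, k3, k4, k5, k6, hHsc, bV, k7, k8, C, F₀, k9, k10, k11, π₀, L, hC, hepi,
    hker, hAnn, hmover⟩ := hfill N π sM sN hst hQ
  -- `∂V`: compact, simply connected, `ℤ`-oriented; `V`: simply connected, `H₂(∂V) → H₂(V)` onto
  haveI : SimplyConnectedSpace C.W := hC.simplyConnectedSpace
  haveI : SimplyConnectedSpace bV.carrier :=
    hC.simplyConnectedSpace_iff_right.1 inferInstance
  obtain ⟨β⟩ := isOrientableOver_of_simplyConnectedSpace ℤ (bV.carrier) (n := 4)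
  -- the lattices are finitely generated free
  obtain ⟨hfin₁, hfree₁⟩ := finite_and_free_freeCohomology_two (M := M₁)
  obtain ⟨hfin₂, hfree₂⟩ := finite_and_free_freeCohomology_two (M := M₂)
  obtain ⟨hfind, hfreed⟩ := finite_and_free_freeCohomology_two (M := bV.carrier)
  haveI := hfin₁; haveI := hfree₁; haveI := hfin₂; haveI := hfree₂; haveI := hfind; haveI := hfreed
  -- `K` transported through `C` is a Lagrangian direct summand of half rank of `H²(∂V)/T`
  obtain ⟨gq, hgq, hK'c, hK'i, hK'r⟩ :=
    hC.exists_homotopyEquiv_lagrangian_graph_map μ ν π β hst hQ α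
  -- "there is a diffeomorphism of `∂V` which induces this isomorphism": `g^*(K') = L`
  obtain ⟨g, hgK⟩ := hmover β _ hK'c hK'i hK'r
  -- the neck-filling cobordism `W₀`
  obtain ⟨W₀, hW₀, ι₁, ι₂, hW₀epi, hi₁s, hi₁t, hi₂s, hi₂t, hi₁W, hi₂W⟩ :=
    MergingCobordism.hmerge_holds M₁ M₂ N d hi₁ hi₂ hjA hjB
  -- the re-gluing `R`
  obtain ⟨Rc, hRsc, J, hJ, hinl, hinr, hvan⟩ := exists_regluing_cobordism_of_boundaryData H bV hepi C hC g W₀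
  -- "Now we calculate what has happened to the second homology group"
  haveI := isPerfPair_freeKroneckerPairing_two N
  haveI := isPerfPair_freeKroneckerPairing_two M₁
  haveI := isPerfPair_freeKroneckerPairing_two M₂
  haveI := isPerfPair_freeKroneckerPairing_two (bV.carrier)
  -- the homological transport `Φ_h = inl_*⁻¹ ∘ inr_*` through `C`
  haveI := hC.isIso_map_inl 2
  haveI := hC.isIso_map_inr 2
  let EInl : singularHomology ℤ ℤ N 2 ≃ₗ[ℤ] singularHomology ℤ ℤ C.W 2 :=
    (asIso (singularHomology.map ℤ ℤ (⟨C.inl, C.continuous_inl⟩ : C(N, C.W)) 2)).toLinearEquiv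
  let EInr : singularHomology ℤ ℤ bV.carrier 2 ≃ₗ[ℤ] singularHomology ℤ ℤ C.W 2 :=
    (asIso (singularHomology.map ℤ ℤ (⟨C.inr, C.continuous_inr⟩ : C(bV.carrier, C.W)) 2)).toLinearEquiv
  have hEInl : ∀ x, EInl x =
      singularHomology.map ℤ ℤ (⟨C.inl, C.continuous_inl⟩ : C(N, C.W)) 2 x := fun x => rfl
  have hEInr : ∀ y, EInr y =
      singularHomology.map ℤ ℤ (⟨C.inr, C.continuous_inr⟩ : C(bV.carrier, C.W)) 2 y := fun y => rfl
  let Φh : singularHomology ℤ ℤ bV.carrier 2 →ₗ[ℤ] singularHomology ℤ ℤ N 2 :=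
    EInl.symm.toLinearMap ∘ₗ EInr.toLinearMap
  let Ψh : singularHomology ℤ ℤ N 2 →ₗ[ℤ] singularHomology ℤ ℤ bV.carrier 2 :=
    EInr.symm.toLinearMap ∘ₗ EInl.toLinearMap
  have hΦΨ : ∀ x, Φh (Ψh x) = x := fun x => by simp [Φh, Ψh]
  have hΨΦ : ∀ y, Ψh (Φh y) = y := fun y => by simp [Φh, Ψh]
  have hΦinl : ∀ y, singularHomology.map ℤ ℤ (⟨C.inl, C.continuous_inl⟩ : C(N, C.W)) 2 (Φh y) =
      singularHomology.map ℤ ℤ (⟨C.inr, C.continuous_inr⟩ : C(bV.carrier, C.W)) 2 y := fun y => by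
    rw [← hEInl, ← hEInr]
    simp [Φh]
  -- `C.inl^*` is onto on `H²/T` (a homotopy equivalence)
  have hinlsurj : Surjective (freeCohomology.map (R := ℤ)
      (⟨C.inl, C.continuous_inl⟩ : C(N, C.W)) 2) := by
    obtain ⟨e₁, he₁⟩ := hC.1
    have hfun : (⟨C.inl, C.continuous_inl⟩ : C(N, C.W)) = e₁.toFun := by
      ext x; exact (congrFun he₁ x).symm
    rw [hfun]
    exact (freeCohomology_bijective_map_of_homotopyEquiv e₁ 2).2
  -- adjointness of `Φ_c = gq^*` and `Φ_h`
  have hΦ : ∀ w y, freeKroneckerPairing N 2 w (Φh y) =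
      freeKroneckerPairing _ 2 (freeCohomology.map (R := ℤ) gq.toFun 2 w) y := fun w y => by
    obtain ⟨a, rfl⟩ := hinlsurj w
    rw [freeKroneckerPairing_map, hΦinl, ← freeKroneckerPairing_map, hgq 2 a]
  have hΦc : Injective (freeCohomology.map (R := ℤ) gq.toFun 2) :=
    (freeCohomology_bijective_map_of_homotopyEquiv gq 2).1
  -- the diffeomorphism `g` in cohomology and homology
  have hgc : Injective (freeCohomology.map (R := ℤ)
      (⟨g, g.continuous⟩ : C(bV.carrier, bV.carrier)) 2) :=
    fun x y hxy => by
      have h' := congrArg (freeCohomology.map (R := ℤ)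
        (⟨g.symm, g.symm.continuous⟩ : C(bV.carrier, bV.carrier)) 2) hxy
      rwa [freeCohomologyMap_symm_apply_map, freeCohomologyMap_symm_apply_map] at h'
  have hgsymm : (⟨g, g.continuous⟩ : C(bV.carrier, bV.carrier)).comp
      (⟨g.symm, g.symm.continuous⟩ : C(bV.carrier, bV.carrier)) = ContinuousMap.id _ :=
    ContinuousMap.ext fun y => g.apply_symm_apply y
  have hsymmg : (⟨g.symm, g.symm.continuous⟩ : C(bV.carrier, bV.carrier)).comp
      (⟨g, g.continuous⟩ : C(bV.carrier, bV.carrier)) = ContinuousMap.id _ :=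
    ContinuousMap.ext fun y => g.symm_apply_apply y
  have hgg' : ∀ y, (singularHomology.map ℤ ℤ (⟨g, g.continuous⟩ : C(bV.carrier, bV.carrier)) 2).hom
      ((singularHomology.map ℤ ℤ (⟨g.symm, g.symm.continuous⟩ : C(bV.carrier, bV.carrier)) 2).hom y) = y := fun y => by
    change (singularHomology.map ℤ ℤ _ 2 ≫ singularHomology.map ℤ ℤ _ 2) y = y
    rw [← singularHomology.map_comp, hgsymm, singularHomology.map_id]; rfl
  have hg'g : ∀ y, (singularHomology.map ℤ ℤ (⟨g.symm, g.symm.continuous⟩ : C(bV.carrier, bV.carrier)) 2).hom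
      ((singularHomology.map ℤ ℤ (⟨g, g.continuous⟩ : C(bV.carrier, bV.carrier)) 2).hom y) = y := fun y => by
    change (singularHomology.map ℤ ℤ _ 2 ≫ singularHomology.map ℤ ℤ _ 2) y = y
    rw [← singularHomology.map_comp, hsymmg, singularHomology.map_id]; rfl
  -- the geometric map `F = jX_* ∘ inl₀_* : H₂(N) → H₂(R)`
  let F : singularHomology ℤ ℤ N 2 →ₗ[ℤ] singularHomology ℤ ℤ Rc.W 2 :=
    (singularHomology.map ℤ ℤ J 2).hom ∘ₗ
      (singularHomology.map ℤ ℤ (⟨W₀.inl, W₀.continuous_inl⟩ : C(N, W₀.W)) 2).hom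
  have hF : Surjective F :=
    ((ModuleCat.epi_iff_surjective _).1 hJ).comp ((ModuleCat.epi_iff_surjective _).1 hW₀epi)
  have hvanF : ∀ y, π₀ y = 0 →
      F (Φh ((singularHomology.map ℤ ℤ (⟨g, g.continuous⟩ : C(bV.carrier, bV.carrier)) 2).hom y)) = 0 :=
    fun y hy => hvan y _ (hker y hy) (hΦinl _)
  -- the computation
  obtain ⟨hS₁, hS₂⟩ := surjective_comp_of_wall_lattice_data_of_annihilator
    (freeKroneckerPairing N 2) (freeKroneckerPairing M₁ 2) (freeKroneckerPairing M₂ 2)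
    (freeKroneckerPairing (bV.carrier) 2)
    (cMc := freeCohomology.map (R := ℤ) d.collapseLeft 2)
    (cNc := freeCohomology.map (R := ℤ) d.collapseRight 2) (sM := sM) (sN := sN)
    (sh := (singularHomology.map ℤ ℤ d.collapseLeft 2).hom)
    (th := (singularHomology.map ℤ ℤ d.collapseRight 2).hom)
    (fun a x => freeKroneckerPairing_map d.collapseLeft a x)
    (fun b x => freeKroneckerPairing_map d.collapseRight b x) hd1 hd2 hd3
    (α := (α : freeCohomology ℤ M₁ 2 →ₗ[ℤ] freeCohomology ℤ M₂ 2)) α.toLinearEquiv.bijective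
    (Φc := freeCohomology.map (R := ℤ) gq.toFun 2) (Φh := Φh) (Ψh := Ψh) hΦ hΦc hΦΨ hΨΦ
    (gc := freeCohomology.map (R := ℤ) (⟨g, g.continuous⟩ : C(bV.carrier, bV.carrier)) 2)
    (gh := (singularHomology.map ℤ ℤ (⟨g, g.continuous⟩ : C(bV.carrier, bV.carrier)) 2).hom)
    (gh' := (singularHomology.map ℤ ℤ (⟨g.symm, g.symm.continuous⟩ : C(bV.carrier, bV.carrier)) 2).hom)
    (fun a y => freeKroneckerPairing_map _ a y) hgc hgg' hg'g
    π₀ (L := L) hAnn hgK (F := F) hF hvanF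
    (i₁ := ι₁) hi₁s hi₁t (i₂ := ι₂) hi₂s hi₂t
  -- the ends of `R` on `H₂`: `inl_* = F ∘ i₁`, `inr_* = F ∘ i₂`, both onto
  haveI : SimplyConnectedSpace Rc.W := hRsc
  have hM : Epi (singularHomology.map ℤ ℤ (⟨Rc.inl, Rc.continuous_inl⟩ : C(M₁, Rc.W)) 2) := by
    rw [ModuleCat.epi_iff_surjective]
    intro x
    obtain ⟨z, rfl⟩ := hS₁ x
    refine ⟨z, ?_⟩
    rw [hinl, singularHomology.map_comp, ModuleCat.comp_apply, ← hi₁W]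
    rfl
  have hN : Epi (singularHomology.map ℤ ℤ (⟨Rc.inr, Rc.continuous_inr⟩ : C(M₂, Rc.W)) 2) := by
    rw [ModuleCat.epi_iff_surjective]
    intro x
    obtain ⟨z, rfl⟩ := hS₂ x
    refine ⟨z, ?_⟩
    rw [hinr, singularHomology.map_comp, ModuleCat.comp_apply, ← hi₂W]
    rfl
  -- "Hence `Hₖ(R, Mᵢ) = 0` for `k ≤ 2` … and `R` is indeed an h-cobordism."
  exact isHCobordant_of_epi_singularHomologyMap_two Rc hM hN

/-- **Wall's Theorem 2 for ONE pair from a Lagrangian filling of a manifold h-cobordant to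
`M₁ # (−M₂)`** (1964, §2 pp. 144–146 with Thm. 1 + Lemma 2 abstracted away).  For closed smooth
simply connected `M₁`, `M₂` with `ℤ`-orientations `μ`, `ν` and isometric intersection forms,
`M₁` and `M₂` are h-cobordant, GIVEN (`hfill`) for every closed smooth simply connected `N` whose
lattice `H²(N)/T` splits as `H²(M₁)/T ⊕ H²(M₂)/T` with `Q_N = Q⟦μ⟧ ⊕ (−Q⟦ν⟧)` (the shape
produced for `N = M₁ # (−M₂)` by `ConnectedSumNeck.exists_decomposition_intersectionForm`): a
compact simply connected smooth `V⁵` with boundary datum `bV` (boundary `∂V = bV.carrier`,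
compact Hausdorff), an h-cobordism `C` from `N` to `∂V`, `H₂(∂V) → H₂(V)` onto, `H₂(V)` free, and
the MOVER: for every `ℤ`-orientation `β` of `∂V` and every direct summand `K ⊆ H²(∂V)/T` of half
rank isotropic for `Q⟦β⟧`, a self-diffeomorphism `g` of `∂V` with
`g^*(K) = im (H²(V)/T → H²(∂V)/T)`.  In Wall's proof `V ∈ ℋ(5, k, 2)` comes from Thm. 1 and
Lemma 2 and the mover from [10] + [11] (every automorph of `Q_{∂V}` realised); here both are the
hypothesis, so that other fillings (the standard filling of `𝕊⁴ # k(S² × S²)`, sequel) can be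
fed in.  PROOF: that of `isHCobordant_of_constructions_pair`, sentence by sentence —
`N = M₁ # (−M₂)` with its lattice splitting (`exists_isOrientedConnectedSum_neg_isCompatible`,
`ConnectedSumNeck.exists_decomposition_intersectionForm`); `hfill`; `K` transported through `C`
is a Lagrangian summand of half rank (`Cobordism.IsHCobordism.exists_homotopyEquiv_lagrangian_graph_map`);
the mover `g`; the merging cobordism (`MergingCobordism.hmerge_holds`); the re-gluing
(`exists_regluing_cobordism_of_boundaryData`); the computation
(`surjective_comp_of_wall_lattice_data`); "Hence … `R` is indeed an h-cobordism"
(`isHCobordant_of_epi_singularHomologyMap_two`).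
[cite: WallJLMS1964, Thm. 2 and §2 pp. 144–146] -/
theorem isHCobordant_of_wallFilling
    (M₁ M₂ : Type) [TopologicalSpace M₁] [T2Space M₁] [SecondCountableTopology M₁]
    [ChartedSpace (𝔼 4) M₁] [CompactSpace M₁] [IsManifold (𝓡 4) ∞ M₁] [SimplyConnectedSpace M₁]
    [TopologicalSpace M₂] [T2Space M₂] [SecondCountableTopology M₂]
    [ChartedSpace (𝔼 4) M₂] [CompactSpace M₂] [IsManifold (𝓡 4) ∞ M₂] [SimplyConnectedSpace M₂]
    (μ : HomologicalOrientation ℤ M₁ 4) (ν : HomologicalOrientation ℤ M₂ 4)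
    (hfill : ∀ (N : Type) [TopologicalSpace N] [T2Space N] [SecondCountableTopology N]
      [ChartedSpace (𝔼 4) N] [CompactSpace N] [IsManifold (𝓡 4) ∞ N] [SimplyConnectedSpace N]
      (π : HomologicalOrientation ℤ N 4)
      (sM : freeCohomology ℤ N 2 →ₗ[ℤ] freeCohomology ℤ M₁ 2)
      (sN : freeCohomology ℤ N 2 →ₗ[ℤ] freeCohomology ℤ M₂ 2),
      Function.Bijective (fun x => (sM x, sN x)) →
      (∀ x y, Q⟦π⟧ x y = Q⟦μ⟧ (sM x) (sM y) - Q⟦ν⟧ (sN x) (sN y)) →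
      ∃ (V : Type) (_ : TopologicalSpace V) (_ : T2Space V) (_ : SecondCountableTopology V)
        (_ : ChartedSpace (EuclideanHalfSpace (4 + 1)) V) (_ : IsManifold (𝓡∂ (4 + 1)) ∞ V)
        (_ : CompactSpace V) (_ : SimplyConnectedSpace V)
        (bV : BoundaryData (𝓡∂ (4 + 1)) V (𝓡 4)) (_ : T2Space bV.carrier)
        (_ : CompactSpace bV.carrier) (C : Cobordism 4 N bV.carrier),
        C.IsHCobordism ∧ Epi (singularHomology.map ℤ ℤ bV.inclC 2) ∧
        Module.Free ℤ (singularHomology ℤ ℤ V 2) ∧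
        ∀ (β : HomologicalOrientation ℤ bV.carrier 4)
          (K : Submodule ℤ (freeCohomology ℤ bV.carrier 2)),
          (∃ K' : Submodule ℤ (freeCohomology ℤ bV.carrier 2), IsCompl K K') →
          (∀ x ∈ K, ∀ y ∈ K, Q⟦β⟧ x y = 0) →
          2 * finrank ℤ K = finrank ℤ (freeCohomology ℤ bV.carrier 2) →
          ∃ g : bV.carrier ≃ₘ⟮𝓡 4, 𝓡 4⟯ bV.carrier,
            Submodule.map (freeCohomology.map (R := ℤ) (⟨g, g.continuous⟩ : C(bV.carrier, bV.carrier)) 2) K =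
              LinearMap.range (freeCohomology.map (R := ℤ) bV.inclC 2))
    (h : (Q⟦μ⟧).Equivalent (Q⟦ν⟧)) : IsHCobordant 4 M₁ M₂ := by
  refine isHCobordant_of_wallFilling_of_annihilator M₁ M₂ μ ν
    (fun N _ _ _ _ _ _ _ π sM sN hst hQ => ?_) h
  obtain ⟨V, k1, k2, k3, k4, k5, k6, hVsc, bV, k7, k8, C, hC, hepi, hfree, hmover⟩ :=
    hfill N π sM sN hst hQ
  haveI : Module.Free ℤ (singularHomology ℤ ℤ V 2) := hfree
  refine ⟨V, k1, k2, k3, k4, k5, k6, hVsc, bV, k7, k8, C, singularHomology ℤ ℤ V 2,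
    inferInstance, inferInstance, inferInstance, (singularHomology.map ℤ ℤ bV.inclC 2).hom,
    LinearMap.range (freeCohomology.map (R := ℤ) bV.inclC 2), hC, hepi, fun y hy => hy, ?_, hmover⟩
  -- `im ι^*` contains (indeed equals) the annihilator of `ker ι_*`: Kronecker duality
  haveI : SimplyConnectedSpace C.W := hC.simplyConnectedSpace
  haveI : SimplyConnectedSpace bV.carrier := hC.simplyConnectedSpace_iff_right.1 inferInstance
  haveI := isPerfPair_freeKroneckerPairing_two (bV.carrier)
  intro c hc
  rw [mem_range_iff_forall_mem_ker_pairing_eq_zero (freeKroneckerPairing bV.carrier 2)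
    (freeKroneckerPairing V 2) ((ModuleCat.epi_iff_surjective _).1 hepi)
    (fun b y => freeKroneckerPairing_map _ b y)
    (LinearMap.IsPerfPair.bijective_left (freeKroneckerPairing bV.carrier 2)).1
    freeKroneckerPairing_surjective]
  exact fun y hy => hc y (LinearMap.mem_ker.1 hy)

/-- **Wall's Theorem 2 for ONE pair from a filling, the mover being allowed to CHOOSE the
isometry** — the form of `isHCobordant_of_wallFilling_of_annihilator` consumed by Wall's trick for
ODD forms.  The filling clause is that of the annihilator version (compact simply connected `V⁵`
with boundary datum `bV`, an h-cobordism `C` from the admissible `N` to `∂V`, `ι_*` onto, a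
projective detector `π₀` of dying classes, `L ⊇ Ann (ker π₀)`), except for the MOVER: instead of
carrying EVERY Lagrangian direct summand onto `L`, it receives the identification
`θ : H²(N)/T → H²(∂V)/T` through `C` (a bijection, isometric up to the sign `d = ±1`:
`Cobordism.IsHCobordism.exists_homotopyEquiv_intersectionForm_map_map`) and returns an isometry
`e : Q⟦μ⟧ ≅ Q⟦ν⟧` TOGETHER with a self-diffeomorphism `g` of `∂V` such that
`g^*(θ(K_e)) = L`, `K_e` the graph of `e` (`graphSubmodule`).  Wall's proof (§2, pp. 144–146)
goes through verbatim, since the conclusion "`M₁` and `M₂` are h-cobordant" does not depend on the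
isometry: the words in Kirby's generators act with TWO orbits on the Lagrangians of an odd
lattice, and the two graphs `K_e`, `K_{e ∘ τ}` (`τ` a reflection in a unit vector) lie in different
orbits (`LatticeFormsCharacteristicParity.lean`), so one of them can always be moved.  No
hypothesis `Q⟦μ⟧ ≅ Q⟦ν⟧` is needed here: the isometry is produced by the mover.  PROOF: that of
`isHCobordant_of_wallFilling_of_annihilator` with the graph step replaced by the mover's choice.
[cite: WallJLMS1964, Thm. 2 and §2 pp. 144–146] -/
theorem isHCobordant_of_wallFilling_of_graphMover
    (M₁ M₂ : Type) [TopologicalSpace M₁] [T2Space M₁] [SecondCountableTopology M₁]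
    [ChartedSpace (𝔼 4) M₁] [CompactSpace M₁] [IsManifold (𝓡 4) ∞ M₁] [SimplyConnectedSpace M₁]
    [TopologicalSpace M₂] [T2Space M₂] [SecondCountableTopology M₂]
    [ChartedSpace (𝔼 4) M₂] [CompactSpace M₂] [IsManifold (𝓡 4) ∞ M₂] [SimplyConnectedSpace M₂]
    (μ : HomologicalOrientation ℤ M₁ 4) (ν : HomologicalOrientation ℤ M₂ 4)
    (hfill : ∀ (N : Type) [TopologicalSpace N] [T2Space N] [SecondCountableTopology N]
      [ChartedSpace (𝔼 4) N] [CompactSpace N] [IsManifold (𝓡 4) ∞ N] [SimplyConnectedSpace N]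
      (π : HomologicalOrientation ℤ N 4)
      (sM : freeCohomology ℤ N 2 →ₗ[ℤ] freeCohomology ℤ M₁ 2)
      (sN : freeCohomology ℤ N 2 →ₗ[ℤ] freeCohomology ℤ M₂ 2),
      Function.Bijective (fun x => (sM x, sN x)) →
      (∀ x y, Q⟦π⟧ x y = Q⟦μ⟧ (sM x) (sM y) - Q⟦ν⟧ (sN x) (sN y)) →
      ∃ (V : Type) (_ : TopologicalSpace V) (_ : T2Space V) (_ : SecondCountableTopology V)
        (_ : ChartedSpace (EuclideanHalfSpace (4 + 1)) V) (_ : IsManifold (𝓡∂ (4 + 1)) ∞ V)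
        (_ : CompactSpace V) (_ : SimplyConnectedSpace V)
        (bV : BoundaryData (𝓡∂ (4 + 1)) V (𝓡 4)) (_ : T2Space bV.carrier)
        (_ : CompactSpace bV.carrier) (C : Cobordism 4 N bV.carrier)
        (F₀ : Type) (_ : AddCommGroup F₀) (_ : Module ℤ F₀) (_ : Module.Projective ℤ F₀)
        (π₀ : singularHomology ℤ ℤ bV.carrier 2 →ₗ[ℤ] F₀)
        (L : Submodule ℤ (freeCohomology ℤ bV.carrier 2)),
        C.IsHCobordism ∧ Epi (singularHomology.map ℤ ℤ bV.inclC 2) ∧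
        (∀ y : singularHomology ℤ ℤ bV.carrier 2, π₀ y = 0 →
          singularHomology.map ℤ ℤ bV.inclC 2 y = 0) ∧
        (∀ c : freeCohomology ℤ bV.carrier 2,
          (∀ y : singularHomology ℤ ℤ bV.carrier 2, π₀ y = 0 →
            freeKroneckerPairing bV.carrier 2 c y = 0) → c ∈ L) ∧
        ∀ (β : HomologicalOrientation ℤ bV.carrier 4)
          (θ : freeCohomology ℤ N 2 →ₗ[ℤ] freeCohomology ℤ bV.carrier 2),
          Function.Bijective θ →
          (∃ d : ℤ, (d = 1 ∨ d = -1) ∧ ∀ x y, Q⟦β⟧ (θ x) (θ y) = d * Q⟦π⟧ x y) →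
          ∃ (e : (Q⟦μ⟧).IsometryEquiv (Q⟦ν⟧)) (g : bV.carrier ≃ₘ⟮𝓡 4, 𝓡 4⟯ bV.carrier),
            Submodule.map (freeCohomology.map (R := ℤ) (⟨g, g.continuous⟩ : C(bV.carrier, bV.carrier)) 2)
              (Submodule.map θ (graphSubmodule sM sN (e : freeCohomology ℤ M₁ 2 →ₗ[ℤ] freeCohomology ℤ M₂ 2))) = L) :
    IsHCobordant 4 M₁ M₂ := by
  classical
  -- "Form the connected sum `N = M₁ # (−M₂)`. Since the signatures … that of `N` is zero."
  obtain ⟨N, i1, i2, i3, i4, i5, i6, i7, o₁, o₂, oN, π, hsum, ho₁, ho₂, hπ⟩ :=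
    exists_isOrientedConnectedSum_neg_isCompatible (n := 4) (by norm_num) M₁ M₂
      (HomologicalOrientationOfSmooth.μE 4) μ ν
  -- the gluing data of `N`, with its SMOOTH disc and gluing maps (kept for the merging step)
  obtain ⟨i₁, i₂, _, jA, jB, hi₁, hi₂, -, -, ⟨hjA, hAo, hjB, hBo, hUn, hRel⟩, hoA, hoB⟩ := hsum
  let d : ConnectedSumNeck 4 M₁ M₂ N :=
    { i₁ := i₁
      i₂ := i₂
      jA := jA
      jB := jB
      continuous_i₁ := hi₁.isEmbedding.continuous
      injective_i₁ := hi₁.isEmbedding.injective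
      continuous_i₂ := hi₂.isEmbedding.continuous
      injective_i₂ := hi₂.isEmbedding.injective
      isEmbedding_jA := hjA.isEmbedding
      isEmbedding_jB := hjB.isEmbedding
      isOpen_range_jA := hAo
      isOpen_range_jB := hBo
      union_range := hUn
      rel := hRel }
  have hL : d.IsOrientedLeft μ π :=
    d.isOrientedLeft_of_isOrientationPreserving hjA (HomologicalOrientationOfSmooth.μE 4) ho₁ hπ hoA
  have hR : d.IsOrientedRight (-ν) π :=
    d.isOrientedRight_of_isOrientationPreserving hjB (HomologicalOrientationOfSmooth.μE 4) ho₂ hπ hoB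
  obtain ⟨sM, sN, hd1, hd2, hd3, hst, hQ'⟩ :=
    d.exists_decomposition_intersectionForm (m := 3) (by norm_num) (k := 2) (by norm_num)
      two_add_two_eq_four hL hR
  have hQ : ∀ x y, Q⟦π⟧ x y = Q⟦μ⟧ (sM x) (sM y) - Q⟦ν⟧ (sN x) (sN y) := fun x y => by
    refine (hQ' x y).trans ?_
    show intersectionForm two_add_two_eq_four μ (sM x) (sM y) +
        intersectionForm two_add_two_eq_four (-ν) (sN x) (sN y) = _
    rw [intersectionForm_neg (HomologicalOrientation.fundamentalClass_neg_holds ℤ M₂ 4)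
      two_add_two_eq_four ν, LinearMap.neg_apply, LinearMap.neg_apply, sub_eq_add_neg]
  -- the filling `V` of `∂V = bV.carrier`, the h-cobordism `C : N ∼ ∂V`, and the mover
  obtain ⟨H, k1, k2, k3, k4, k5, k6, hHsc, bV, k7, k8, C, F₀, k9, k10, k11, π₀, L, hC, hepi,
    hker, hAnn, hmover⟩ := hfill N π sM sN hst hQ
  -- `∂V`: compact, simply connected, `ℤ`-oriented; `V`: simply connected, `H₂(∂V) → H₂(V)` onto
  haveI : SimplyConnectedSpace C.W := hC.simplyConnectedSpace
  haveI : SimplyConnectedSpace bV.carrier :=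
    hC.simplyConnectedSpace_iff_right.1 inferInstance
  obtain ⟨β⟩ := isOrientableOver_of_simplyConnectedSpace ℤ (bV.carrier) (n := 4)
  -- the lattices are finitely generated free
  obtain ⟨hfin₁, hfree₁⟩ := finite_and_free_freeCohomology_two (M := M₁)
  obtain ⟨hfin₂, hfree₂⟩ := finite_and_free_freeCohomology_two (M := M₂)
  obtain ⟨hfind, hfreed⟩ := finite_and_free_freeCohomology_two (M := bV.carrier)
  haveI := hfin₁; haveI := hfree₁; haveI := hfin₂; haveI := hfree₂; haveI := hfind; haveI := hfreed
  -- the homotopy equivalence `gq : ∂V ≃ N` through `C`, isometric up to sign on `H²/T`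
  obtain ⟨gq, dg, hdg, hgq, hβform⟩ :=
    hC.exists_homotopyEquiv_intersectionForm_map_map two_add_two_eq_four π β
  -- the mover chooses the isometry `α` and the diffeomorphism `g`: `g^*(gq^*(graph α)) = L`
  obtain ⟨α, g, hgK⟩ := hmover β (freeCohomology.map (R := ℤ) gq.toFun 2)
    (freeCohomology_bijective_map_of_homotopyEquiv gq 2) ⟨dg, hdg, hβform⟩
  -- the neck-filling cobordism `W₀`
  obtain ⟨W₀, hW₀, ι₁, ι₂, hW₀epi, hi₁s, hi₁t, hi₂s, hi₂t, hi₁W, hi₂W⟩ :=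
    MergingCobordism.hmerge_holds M₁ M₂ N d hi₁ hi₂ hjA hjB
  -- the re-gluing `R`
  obtain ⟨Rc, hRsc, J, hJ, hinl, hinr, hvan⟩ := exists_regluing_cobordism_of_boundaryData H bV hepi C hC g W₀
  -- "Now we calculate what has happened to the second homology group"
  haveI := isPerfPair_freeKroneckerPairing_two N
  haveI := isPerfPair_freeKroneckerPairing_two M₁
  haveI := isPerfPair_freeKroneckerPairing_two M₂
  haveI := isPerfPair_freeKroneckerPairing_two (bV.carrier)
  -- the homological transport `Φ_h = inl_*⁻¹ ∘ inr_*` through `C`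
  haveI := hC.isIso_map_inl 2
  haveI := hC.isIso_map_inr 2
  let EInl : singularHomology ℤ ℤ N 2 ≃ₗ[ℤ] singularHomology ℤ ℤ C.W 2 :=
    (asIso (singularHomology.map ℤ ℤ (⟨C.inl, C.continuous_inl⟩ : C(N, C.W)) 2)).toLinearEquiv
  let EInr : singularHomology ℤ ℤ bV.carrier 2 ≃ₗ[ℤ] singularHomology ℤ ℤ C.W 2 :=
    (asIso (singularHomology.map ℤ ℤ (⟨C.inr, C.continuous_inr⟩ : C(bV.carrier, C.W)) 2)).toLinearEquiv
  have hEInl : ∀ x, EInl x =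
      singularHomology.map ℤ ℤ (⟨C.inl, C.continuous_inl⟩ : C(N, C.W)) 2 x := fun x => rfl
  have hEInr : ∀ y, EInr y =
      singularHomology.map ℤ ℤ (⟨C.inr, C.continuous_inr⟩ : C(bV.carrier, C.W)) 2 y := fun y => rfl
  let Φh : singularHomology ℤ ℤ bV.carrier 2 →ₗ[ℤ] singularHomology ℤ ℤ N 2 :=
    EInl.symm.toLinearMap ∘ₗ EInr.toLinearMap
  let Ψh : singularHomology ℤ ℤ N 2 →ₗ[ℤ] singularHomology ℤ ℤ bV.carrier 2 :=
    EInr.symm.toLinearMap ∘ₗ EInl.toLinearMap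
  have hΦΨ : ∀ x, Φh (Ψh x) = x := fun x => by simp [Φh, Ψh]
  have hΨΦ : ∀ y, Ψh (Φh y) = y := fun y => by simp [Φh, Ψh]
  have hΦinl : ∀ y, singularHomology.map ℤ ℤ (⟨C.inl, C.continuous_inl⟩ : C(N, C.W)) 2 (Φh y) =
      singularHomology.map ℤ ℤ (⟨C.inr, C.continuous_inr⟩ : C(bV.carrier, C.W)) 2 y := fun y => by
    rw [← hEInl, ← hEInr]
    simp [Φh]
  -- `C.inl^*` is onto on `H²/T` (a homotopy equivalence)
  have hinlsurj : Surjective (freeCohomology.map (R := ℤ)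
      (⟨C.inl, C.continuous_inl⟩ : C(N, C.W)) 2) := by
    obtain ⟨e₁, he₁⟩ := hC.1
    have hfun : (⟨C.inl, C.continuous_inl⟩ : C(N, C.W)) = e₁.toFun := by
      ext x; exact (congrFun he₁ x).symm
    rw [hfun]
    exact (freeCohomology_bijective_map_of_homotopyEquiv e₁ 2).2
  -- adjointness of `Φ_c = gq^*` and `Φ_h`
  have hΦ : ∀ w y, freeKroneckerPairing N 2 w (Φh y) =
      freeKroneckerPairing _ 2 (freeCohomology.map (R := ℤ) gq.toFun 2 w) y := fun w y => by
    obtain ⟨a, rfl⟩ := hinlsurj w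
    rw [freeKroneckerPairing_map, hΦinl, ← freeKroneckerPairing_map, hgq 2 a]
  have hΦc : Injective (freeCohomology.map (R := ℤ) gq.toFun 2) :=
    (freeCohomology_bijective_map_of_homotopyEquiv gq 2).1
  -- the diffeomorphism `g` in cohomology and homology
  have hgc : Injective (freeCohomology.map (R := ℤ)
      (⟨g, g.continuous⟩ : C(bV.carrier, bV.carrier)) 2) :=
    fun x y hxy => by
      have h' := congrArg (freeCohomology.map (R := ℤ)
        (⟨g.symm, g.symm.continuous⟩ : C(bV.carrier, bV.carrier)) 2) hxy
      rwa [freeCohomologyMap_symm_apply_map, freeCohomologyMap_symm_apply_map] at h'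
  have hgsymm : (⟨g, g.continuous⟩ : C(bV.carrier, bV.carrier)).comp
      (⟨g.symm, g.symm.continuous⟩ : C(bV.carrier, bV.carrier)) = ContinuousMap.id _ :=
    ContinuousMap.ext fun y => g.apply_symm_apply y
  have hsymmg : (⟨g.symm, g.symm.continuous⟩ : C(bV.carrier, bV.carrier)).comp
      (⟨g, g.continuous⟩ : C(bV.carrier, bV.carrier)) = ContinuousMap.id _ :=
    ContinuousMap.ext fun y => g.symm_apply_apply y
  have hgg' : ∀ y, (singularHomology.map ℤ ℤ (⟨g, g.continuous⟩ : C(bV.carrier, bV.carrier)) 2).hom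
      ((singularHomology.map ℤ ℤ (⟨g.symm, g.symm.continuous⟩ : C(bV.carrier, bV.carrier)) 2).hom y) = y := fun y => by
    change (singularHomology.map ℤ ℤ _ 2 ≫ singularHomology.map ℤ ℤ _ 2) y = y
    rw [← singularHomology.map_comp, hgsymm, singularHomology.map_id]; rfl
  have hg'g : ∀ y, (singularHomology.map ℤ ℤ (⟨g.symm, g.symm.continuous⟩ : C(bV.carrier, bV.carrier)) 2).hom
      ((singularHomology.map ℤ ℤ (⟨g, g.continuous⟩ : C(bV.carrier, bV.carrier)) 2).hom y) = y := fun y => by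
    change (singularHomology.map ℤ ℤ _ 2 ≫ singularHomology.map ℤ ℤ _ 2) y = y
    rw [← singularHomology.map_comp, hsymmg, singularHomology.map_id]; rfl
  -- the geometric map `F = jX_* ∘ inl₀_* : H₂(N) → H₂(R)`
  let F : singularHomology ℤ ℤ N 2 →ₗ[ℤ] singularHomology ℤ ℤ Rc.W 2 :=
    (singularHomology.map ℤ ℤ J 2).hom ∘ₗ
      (singularHomology.map ℤ ℤ (⟨W₀.inl, W₀.continuous_inl⟩ : C(N, W₀.W)) 2).hom
  have hF : Surjective F :=
    ((ModuleCat.epi_iff_surjective _).1 hJ).comp ((ModuleCat.epi_iff_surjective _).1 hW₀epi)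
  have hvanF : ∀ y, π₀ y = 0 →
      F (Φh ((singularHomology.map ℤ ℤ (⟨g, g.continuous⟩ : C(bV.carrier, bV.carrier)) 2).hom y)) = 0 :=
    fun y hy => hvan y _ (hker y hy) (hΦinl _)
  -- the computation
  obtain ⟨hS₁, hS₂⟩ := surjective_comp_of_wall_lattice_data_of_annihilator
    (freeKroneckerPairing N 2) (freeKroneckerPairing M₁ 2) (freeKroneckerPairing M₂ 2)
    (freeKroneckerPairing (bV.carrier) 2)
    (cMc := freeCohomology.map (R := ℤ) d.collapseLeft 2)
    (cNc := freeCohomology.map (R := ℤ) d.collapseRight 2) (sM := sM) (sN := sN)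
    (sh := (singularHomology.map ℤ ℤ d.collapseLeft 2).hom)
    (th := (singularHomology.map ℤ ℤ d.collapseRight 2).hom)
    (fun a x => freeKroneckerPairing_map d.collapseLeft a x)
    (fun b x => freeKroneckerPairing_map d.collapseRight b x) hd1 hd2 hd3
    (α := (α : freeCohomology ℤ M₁ 2 →ₗ[ℤ] freeCohomology ℤ M₂ 2)) α.toLinearEquiv.bijective
    (Φc := freeCohomology.map (R := ℤ) gq.toFun 2) (Φh := Φh) (Ψh := Ψh) hΦ hΦc hΦΨ hΨΦ
    (gc := freeCohomology.map (R := ℤ) (⟨g, g.continuous⟩ : C(bV.carrier, bV.carrier)) 2)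
    (gh := (singularHomology.map ℤ ℤ (⟨g, g.continuous⟩ : C(bV.carrier, bV.carrier)) 2).hom)
    (gh' := (singularHomology.map ℤ ℤ (⟨g.symm, g.symm.continuous⟩ : C(bV.carrier, bV.carrier)) 2).hom)
    (fun a y => freeKroneckerPairing_map _ a y) hgc hgg' hg'g
    π₀ (L := L) hAnn hgK (F := F) hF hvanF
    (i₁ := ι₁) hi₁s hi₁t (i₂ := ι₂) hi₂s hi₂t
  -- the ends of `R` on `H₂`: `inl_* = F ∘ i₁`, `inr_* = F ∘ i₂`, both onto
  haveI : SimplyConnectedSpace Rc.W := hRsc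
  have hM : Epi (singularHomology.map ℤ ℤ (⟨Rc.inl, Rc.continuous_inl⟩ : C(M₁, Rc.W)) 2) := by
    rw [ModuleCat.epi_iff_surjective]
    intro x
    obtain ⟨z, rfl⟩ := hS₁ x
    refine ⟨z, ?_⟩
    rw [hinl, singularHomology.map_comp, ModuleCat.comp_apply, ← hi₁W]
    rfl
  have hN : Epi (singularHomology.map ℤ ℤ (⟨Rc.inr, Rc.continuous_inr⟩ : C(M₂, Rc.W)) 2) := by
    rw [ModuleCat.epi_iff_surjective]
    intro x
    obtain ⟨z, rfl⟩ := hS₂ x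
    refine ⟨z, ?_⟩
    rw [hinr, singularHomology.map_comp, ModuleCat.comp_apply, ← hi₂W]
    rfl
  -- "Hence `Hₖ(R, Mᵢ) = 0` for `k ≤ 2` … and `R` is indeed an h-cobordism."
  exact isHCobordant_of_epi_singularHomologyMap_two Rc hM hN

end Filling

end Literature.Topology.FourManifolds

end
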